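import Mathlib
import HarnessLib
import Summits.HubbardSuperconductivity.HubbardSuperconductivity.Theorems.KLProgrammeKLRegimeFrameWindowCount
import Summits.HubbardSuperconductivity.HubbardSuperconductivity.Theorems.KLProgrammeKLRegimeEngineV8PairTransferRelBarIdx
import Summits.HubbardSuperconductivity.HubbardSuperconductivity.Theorems.KLProgrammeKLRegimeEngineValueClauseReduction

/-!
# Route `KLProgramme` — ENGINE child gen 8 (stmt-HubbardSuperconductivity-20437 `KLRegimeEngineV17F2`), located item #19 «(c)-DRESSING-AVG» (plan g21 (R90)), input
# (W2)(C): WINDOWED soft sums and the WINDOWED mass of the class-#5 transfer weight — the weights are SPREAD along the Fermi curve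
# (cell gate-hubbard-kl, seat hubbard-kl-p1 g13, EdgeFacts lane)

WHY.  The dressing/cross convolutions of the relative step (`pairTransferRelAt_succ_keyed`, p592121: `Σ_c Bar(x,c)·|w_c|`) can only be hosted if the gained profile
`klRelGain n (|x − c|_𝕋)` is AVERAGED against the label distribution of the weight `w` (sup × mass needs `4θ ≤ 2^{−n}`, dead at deep `n`).  The distribution statement
is a WINDOWED mass line: the part of the weight's mass carried by the labels within torus distance `ρ` of any centre is at most the fraction `ρ/π + 1/L` of the total
(up to the count constants).  This file proves it for the soft sums and for the pinned/relative transfer weight `tₙ^K[D]` of any symbol `D` admissible at a scale `m ≥ n`: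

* §1 `sum_window_one_sub_cutoff_div_sqrt_le_linear` — the Literature infrared phase-space sum `sum_one_sub_cutoff_div_sqrt_le_linear` (Pedra–Salmhofer Lemma 5.1 form)
  RESTRICTED TO A WINDOW `W` of momenta, from a level count of the window only (`#{p ∈ W : |e p| < η} ≤ c₁ηL² + c₂L`): the band is continued by the constant `Λ` off
  the window, where the cutoff remainder vanishes — no new analysis.
* §2 **`sum_window_softSymbol_mul_norm_propCT_le`** — on an admissible frame (`FrameOK`), `klBetaMin ≤ β ≤ L`, `0 ≤ φ ≤ 1 − w^K_{Λ_m}`, centre `x`, radius `ρ ≥ 0`: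
  `Σ_{k : |p_{k⃗−x⃗}|_𝕋 ≤ ρ} |φ(k)|·‖ĝ_K(k)‖ ≤ 15381·(ρ/π + 1/L)·Λ_m·βL²` (total: `≤ 15367·Λ_m·βL²`, p581438) — the windowed count is p1's `card_frameLevel_lt_torusWindow_le`.
* §3 **`sum_window_abs_klTransferWeight_le`** — `Σ_{p : |p − x|_𝕋 ≤ ρ} |tₙ^K[D](Qm, p)| ≤ 61524·(ρ/π + 1/L)·4^{−(m−n)}` for `0 ≤ D ≤ 1 − w^K_{Λ_m}`, `n ≤ m` (total:
  `≤ 4·15367·4^{−(m−n)}`, p585429/p590284) — the two rungs `w_{Λₙ}⊗D`, `D⊗w_{Λₙ}`, the hard line `≤ 2/Λₙ`, the soft line windowed around `Qm − x` resp. `x`; and the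
  index-family forms `sum_window_abs_klTransferWeight_compl_sub_compl_le` (`D = s_{n,m} − s_{n,m′} = s_{m′,m}`: `≤ 61524·(ρ/π + 1/L)·4^{−(m′−n)}`, both orders of the
  difference of the two members' weights), and the `A·η` shapes `…_linear` (`π/L ≤ η`: the `1/L` rounding absorbed) that the door's layer cake
  `klam_relGain_angular_le` (k3c1-p1, p593991) consumes with `η₀ = π/L`.
(D) — the layer-cake of these windows against `klRelGain n` — is k3c1-p1's `klam_relGain_angular_le` (p593991): with `A = (2C/π)·4^{−(m′−n)}`, `Z = 4·15367·4^{−(m′−n)}`,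
`I = 2n` it gives `Σ_c klRelGain n(|x−c|_𝕋)|w_c| ≤ ε_n·4^{−(m′−n)}`, `ε_n ≍ (n+2)²Λₙ`.  (W2-ρ) (the slice rung profiles) follows in the next EdgeFacts file.
Everything is proved; no definition; nothing about the model is asserted.  0 kit · 0 lit.
-/

noncomputable section

namespace Summit.HubbardSuperconductivity.HubbardSuperconductivity.Theorems.KLRegimeSplit

set_option linter.dupNamespace false -- summit = problem name (single-conjunct summit), D-0017

open Real Finset Literature.MathematicalPhysics.QuantumLattice Literature.Probability.LatticeModels
open Summit.HubbardSuperconductivity.HubbardSuperconductivity.Theorems.DispersionFlow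
open Summit.HubbardSuperconductivity.HubbardSuperconductivity.Theorems.KLProgrammeLegKernels
open Summit.HubbardSuperconductivity.HubbardSuperconductivity.Theorems.TwoPointAssembly

/-! ## §1 The infrared phase-space sum restricted to a window -/

section Window

variable {L M : ℕ} [NeZero L]

/-- **Windowed scale-linear infrared phase-space sum.**  For a band `e : (ℤ/Lℤ)² → ℝ`, a window `W ⊆ (ℤ/Lℤ)²`, `0 < β ≤ L`, `π/β ≤ Λ`, and a level count OF THE
WINDOW `#{p ∈ W : |e p| < η} ≤ c₁ηL² + c₂L` for `0 < η ≤ Λ`:  `Σ_{(i,p), p ∈ W} (1 − χ₂((ω_i² + e(p)²)/Λ²))/√(ω_i² + e(p)²) ≤ (7c₁ + 4c₂)·Λ·βL²` — the Literature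
lemma `sum_one_sub_cutoff_div_sqrt_le_linear` applied to the band continued by the constant `Λ` off `W` (there the cutoff remainder vanishes). -/
theorem sum_window_one_sub_cutoff_div_sqrt_le_linear {β : ℝ} (hβ : 0 < β) (e : TorusSite 2 L → ℝ) (W : Finset (TorusSite 2 L))
    {Λ c₁ c₂ : ℝ} (hΛ : 0 < Λ) (hΛβ : Real.pi / β ≤ Λ) (hβL : β ≤ L) (hc₁ : 0 ≤ c₁) (hc₂ : 0 ≤ c₂)
    (hcount : ∀ η : ℝ, 0 < η → η ≤ Λ → ((W.filter fun p => |e p| < η).card : ℝ) ≤ c₁ * η * (L : ℝ) ^ 2 + c₂ * L) :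
    ∑ k ∈ (univ : Finset (FreqMomentum L M)).filter (fun k => k.2 ∈ W),
        (1 - salmhoferCutoff ((matsubaraFreq β M k.1 ^ 2 + e k.2 ^ 2) / Λ ^ 2)) / Real.sqrt (matsubaraFreq β M k.1 ^ 2 + e k.2 ^ 2) ≤
      (7 * c₁ + 4 * c₂) * Λ * β * (L : ℝ) ^ 2 := by
  classical
  -- the band continued by `Λ` off the window
  set e' : TorusSite 2 L → ℝ := fun p => if p ∈ W then e p else Λ with he'
  -- its level count is the window's
  have hcount' : ∀ η : ℝ, 0 < η → η ≤ Λ →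
      (((univ : Finset (TorusSite 2 L)).filter fun p => |e' p| < η).card : ℝ) ≤ c₁ * η * (L : ℝ) ^ 2 + c₂ * L := by
    intro η hη hηΛ
    refine le_trans ?_ (hcount η hη hηΛ)
    exact_mod_cast Finset.card_le_card fun p hp => by
      rw [Finset.mem_filter] at hp ⊢
      by_cases hW : p ∈ W
      · refine ⟨hW, ?_⟩
        have h := hp.2
        have hval : e' p = e p := by simp only [he', if_pos hW]
        rwa [hval] at h
      · exfalso
        have h := hp.2
        have hval : e' p = Λ := by simp only [he', if_neg hW]
        rw [hval, abs_of_pos hΛ] at h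
        linarith
  have main := sum_one_sub_cutoff_div_sqrt_le_linear (M := M) hβ e' hΛ hΛβ hβL hc₁ hc₂ hcount'
  -- the two sums agree: off the window the summand of `e'` vanishes
  rw [Finset.sum_filter]
  refine le_trans (le_of_eq ?_) main
  refine Finset.sum_congr rfl fun k _ => ?_
  by_cases hW : k.2 ∈ W
  · have hval : e' k.2 = e k.2 := by simp only [he', if_pos hW]
    rw [if_pos hW, hval]
  · have hval : e' k.2 = Λ := by simp only [he', if_neg hW]
    rw [if_neg hW, hval]
    have h1 : salmhoferCutoff ((matsubaraFreq β M k.1 ^ 2 + Λ ^ 2) / Λ ^ 2) = 1 := by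
      refine salmhoferCutoff_of_ge ?_
      rw [le_div_iff₀ (by positivity)]
      nlinarith [sq_nonneg (matsubaraFreq β M k.1)]
    rw [h1, sub_self, zero_div]

end Window

/-! ## §2 Windowed soft sums on admissible frames -/

section Soft

variable {L M : ℕ} [NeZero L] (β μ : ℝ) (K : TrigPolyC4v) {R : RenConsts} {U : ℝ} {N : ℕ}

/-- The windowed level count in the `c₁ηL² + c₂L` shape: `#{p : |e_K(p)| < η, |p − x|_𝕋 ≤ ρ} ≤ 1795(ρ/π + 1/L)·η·L² + 704(ρ/π + 1/L)·L` (`FrameOK`, `0 ≤ η < 3/80`, `0 ≤ ρ`). -/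
theorem card_frameLevel_lt_torusWindow_le_shape (hK : FrameOK R U N μ K) {η : ℝ} (hη : 0 ≤ η) (hηr : η < 3 / 80) (x : TorusSite 2 L) {ρ : ℝ}
    (hρ : 0 ≤ ρ) :
    ((((univ : Finset (TorusSite 2 L)).filter fun p => klTorusNorm L (p - x) ≤ ρ).filter fun p => |nambuXiCT L μ K p| < η).card : ℝ) ≤
      1795 * (ρ / π + ((L : ℝ))⁻¹) * η * (L : ℝ) ^ 2 + 704 * (ρ / π + ((L : ℝ))⁻¹) * L := by
  have hL : (0 : ℝ) < L := Nat.cast_pos.2 (Nat.pos_of_ne_zero (NeZero.ne L))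
  have h := card_frameLevel_lt_torusWindow_le (L := L) hK hη hηr x hρ
  have hset : (((univ : Finset (TorusSite 2 L)).filter fun p => klTorusNorm L (p - x) ≤ ρ).filter fun p => |nambuXiCT L μ K p| < η) =
      (univ : Finset (TorusSite 2 L)).filter fun p => |nambuXiCT L μ K p| < η ∧ klTorusNorm L (p - x) ≤ ρ := by
    ext p
    simp only [Finset.mem_filter, Finset.mem_univ, true_and]
    tauto
  rw [hset]
  refine h.trans (le_of_eq ?_)
  field_simp

/-- **WINDOWED SOFT SUM on an admissible frame**: `FrameOK`, `klBetaMin ≤ β ≤ L`, `0 ≤ φ ≤ 1 − w^K_{Λ_m}`, centre `x`, radius `ρ ≥ 0` ⇒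
`Σ_{k : |p_{k⃗} − p_{x⃗}|_𝕋 ≤ ρ} |φ(k)|·‖ĝ_K(k)‖ ≤ 15381·(ρ/π + 1/L)·Λ_m·βL²` — the fraction `ρ/π + 1/L` of the total's bound (`15367·Λ_m·βL²`, p581438; `15381 = 7·1795 + 4·704`). -/
theorem sum_window_softSymbol_mul_norm_propCT_le (hK : FrameOK R U N μ K) (hβ : klBetaMin ≤ β) (hβL : β ≤ L) (m : ℕ)
    {φ : FreqMomentum L M → ℝ} (hφ : ∀ k, 0 ≤ φ k ∧ φ k ≤ 1 - hubbardCutoffWeightCT L M β μ K (klScale klE0 m) k) (x : TorusSite 2 L)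
    {ρ : ℝ} (hρ : 0 ≤ ρ) :
    ∑ k ∈ (univ : Finset (FreqMomentum L M)).filter (fun k => klTorusNorm L (k.2 - x) ≤ ρ), |φ k| * ‖propCT L M β μ K k‖ ≤
      15381 * (ρ / π + ((L : ℝ))⁻¹) * klScale klE0 m * β * (L : ℝ) ^ 2 := by
  have hβ0 : 0 < β := pos_of_klBetaMin_le hβ
  have hΛ : 0 < klScale klE0 m := klth_klScale_pos m
  have hL : (0 : ℝ) < L := lt_of_lt_of_le hβ0 hβL
  have hπ := Real.pi_pos
  rcases le_or_gt (Real.pi / β) (klScale klE0 m) with hth | hth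
  · set W : Finset (TorusSite 2 L) := (univ : Finset (TorusSite 2 L)).filter fun p => klTorusNorm L (p - x) ≤ ρ with hW
    have hWset : ((univ : Finset (FreqMomentum L M)).filter fun k => klTorusNorm L (k.2 - x) ≤ ρ) =
        (univ : Finset (FreqMomentum L M)).filter fun k => k.2 ∈ W := by
      ext k; simp [hW]
    have hc : 0 ≤ ρ / π + ((L : ℝ))⁻¹ := by positivity
    have hcount : ∀ η : ℝ, 0 < η → η ≤ klScale klE0 m →
        ((W.filter fun p => |nambuXiCT L μ K p| < η).card : ℝ) ≤
          1795 * (ρ / π + ((L : ℝ))⁻¹) * η * (L : ℝ) ^ 2 + 704 * (ρ / π + ((L : ℝ))⁻¹) * L :=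
      fun η hη hηΛ => card_frameLevel_lt_torusWindow_le_shape μ K hK hη.le (lt_of_le_of_lt hηΛ (klScale_klE0_lt_tube m)) x hρ
    have main := sum_window_one_sub_cutoff_div_sqrt_le_linear (M := M) hβ0 (nambuXiCT L μ K) W hΛ hth hβL
      (by positivity : (0 : ℝ) ≤ 1795 * (ρ / π + ((L : ℝ))⁻¹)) (by positivity : (0 : ℝ) ≤ 704 * (ρ / π + ((L : ℝ))⁻¹)) hcount
    rw [hWset]
    calc ∑ k ∈ (univ : Finset (FreqMomentum L M)).filter (fun k => k.2 ∈ W), |φ k| * ‖propCT L M β μ K k‖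
        ≤ ∑ k ∈ (univ : Finset (FreqMomentum L M)).filter (fun k => k.2 ∈ W),
            (1 - hubbardCutoffWeightCT L M β μ K (klScale klE0 m) k) / Real.sqrt (matsubaraFreq β M k.1 ^ 2 + nambuXiCT L μ K k.2 ^ 2) :=
          sum_le_sum fun k _ => by rw [abs_of_nonneg (hφ k).1]; exact softSymbol_mul_norm_propCT_le β μ K hφ k
      _ ≤ (7 * (1795 * (ρ / π + ((L : ℝ))⁻¹)) + 4 * (704 * (ρ / π + ((L : ℝ))⁻¹))) * klScale klE0 m * β * (L : ℝ) ^ 2 := main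
      _ = 15381 * (ρ / π + ((L : ℝ))⁻¹) * klScale klE0 m * β * (L : ℝ) ^ 2 := by ring
  · have hφ0 : ∀ k, φ k = 0 := softSymbol_eq_zero_of_lt_pi_div β μ K hβ0 hΛ hth hφ
    simp only [hφ0, abs_zero, zero_mul, sum_const_zero]
    positivity

end Soft

/-! ## §3 The windowed mass of the transfer weight -/

section Transfer

variable {L M : ℕ} [NeZero L] (β μ : ℝ) (K : TrigPolyC4v) {R : RenConsts} {U : ℝ} {N : ℕ}

/-- Windowed one-sided bubble mass, hard LEFT line: `|a(k)|‖ĝ_K(k)‖ ≤ A` ⇒ `Σ_{p : |p − x|_𝕋 ≤ ρ} |B(a,b)(Qm,p)| ≤ (βL²)⁻¹·A·Σ_{k : |k⃗ − (Qm − x)|_𝕋 ≤ ρ} |b(k)|‖ĝ_K(k)‖`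
(the partner of a windowed label sits in the reflected window around `Qm − x`). -/
theorem sum_window_abs_klBubbleMass_le_of_left (hβ : 0 < β) {a : FreqMomentum L M → ℝ} (b : FreqMomentum L M → ℝ) {A : ℝ}
    (hA : ∀ k, |a k| * ‖propCT L M β μ K k‖ ≤ A) (Qm x : TorusSite 2 L) (ρ : ℝ) :
    ∑ p ∈ (univ : Finset (TorusSite 2 L)).filter (fun p => klTorusNorm L (p - x) ≤ ρ), |klBubbleMass L M β μ K a b Qm p| ≤
      (β * (L : ℝ) ^ 2)⁻¹ * A *
        ∑ k ∈ (univ : Finset (FreqMomentum L M)).filter (fun k => klTorusNorm L (k.2 - (Qm - x)) ≤ ρ), |b k| * ‖propCT L M β μ K k‖ := by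
  classical
  have hc : 0 ≤ (β * (L : ℝ) ^ 2)⁻¹ := by positivity
  set soft : FreqMomentum L M → ℝ := fun k => |b k| * ‖propCT L M β μ K k‖ with hsoft
  have hsoft0 : ∀ k, 0 ≤ soft k := fun k => mul_nonneg (abs_nonneg _) (norm_nonneg _)
  -- the window of `p` is the window of `Qm − p` around `Qm − x`
  have hwin : ∀ p : TorusSite 2 L, klTorusNorm L (p - x) = klTorusNorm L ((Qm - p) - (Qm - x)) := fun p => by
    rw [show Qm - p - (Qm - x) = x - p by abel, klvr_klTorusNorm_sub_comm]
  -- reindex the windowed partner sum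
  have hreindex : ∑ p : TorusSite 2 L, (if klTorusNorm L (p - x) ≤ ρ then ∑ ν : MatsubaraIdx M, soft (ν.rev, Qm - p) else 0) =
      ∑ k ∈ (univ : Finset (FreqMomentum L M)).filter (fun k => klTorusNorm L (k.2 - (Qm - x)) ≤ ρ), soft k := by
    have h1 : ∀ p : TorusSite 2 L, ∑ ν : MatsubaraIdx M, soft (ν.rev, Qm - p) = ∑ ν : MatsubaraIdx M, soft (ν, Qm - p) := fun p =>
      Equiv.sum_comp Fin.revPerm (fun ν => soft (ν, Qm - p))
    simp_rw [h1, hwin]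
    have h2 : ∑ p : TorusSite 2 L, (if klTorusNorm L ((Qm - p) - (Qm - x)) ≤ ρ then ∑ ν : MatsubaraIdx M, soft (ν, Qm - p) else 0) =
        ∑ q : TorusSite 2 L, (if klTorusNorm L (q - (Qm - x)) ≤ ρ then ∑ ν : MatsubaraIdx M, soft (ν, q) else 0) :=
      Fintype.sum_equiv (Equiv.subLeft Qm) _ _ fun p => rfl
    rw [h2, Finset.sum_filter, Fintype.sum_prod_type, Finset.sum_comm]
    refine Finset.sum_congr rfl fun q _ => ?_
    split_ifs with h
    · rfl
    · simp
  rw [Finset.sum_filter]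
  calc ∑ p, (if klTorusNorm L (p - x) ≤ ρ then |klBubbleMass L M β μ K a b Qm p| else 0)
      ≤ ∑ p, (if klTorusNorm L (p - x) ≤ ρ then (β * (L : ℝ) ^ 2)⁻¹ * (A * ∑ ν : MatsubaraIdx M, soft (ν.rev, Qm - p)) else 0) := by
        refine sum_le_sum fun p _ => ?_
        split_ifs with h
        · refine (abs_klBubbleMass_le β μ K hβ a b Qm p).trans ?_
          refine mul_le_mul_of_nonneg_left ?_ hc
          rw [Finset.mul_sum]
          exact sum_le_sum fun ν _ => mul_le_mul_of_nonneg_right (hA _) (hsoft0 _)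
        · exact le_rfl
    _ = (β * (L : ℝ) ^ 2)⁻¹ * A * ∑ p, (if klTorusNorm L (p - x) ≤ ρ then ∑ ν : MatsubaraIdx M, soft (ν.rev, Qm - p) else 0) := by
        rw [Finset.mul_sum]
        refine Finset.sum_congr rfl fun p _ => ?_
        split_ifs <;> ring
    _ = (β * (L : ℝ) ^ 2)⁻¹ * A *
          ∑ k ∈ (univ : Finset (FreqMomentum L M)).filter (fun k => klTorusNorm L (k.2 - (Qm - x)) ≤ ρ), soft k := by rw [hreindex]

/-- Windowed one-sided bubble mass, hard RIGHT line: `|b(k)|‖ĝ_K(k)‖ ≤ A` ⇒ `Σ_{p : |p − x|_𝕋 ≤ ρ} |B(a,b)(Qm,p)| ≤ (βL²)⁻¹·A·Σ_{k : |k⃗ − x|_𝕋 ≤ ρ} |a(k)|‖ĝ_K(k)‖`. -/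
theorem sum_window_abs_klBubbleMass_le_of_right (hβ : 0 < β) (a : FreqMomentum L M → ℝ) {b : FreqMomentum L M → ℝ} {A : ℝ}
    (hA : ∀ k, |b k| * ‖propCT L M β μ K k‖ ≤ A) (Qm x : TorusSite 2 L) (ρ : ℝ) :
    ∑ p ∈ (univ : Finset (TorusSite 2 L)).filter (fun p => klTorusNorm L (p - x) ≤ ρ), |klBubbleMass L M β μ K a b Qm p| ≤
      (β * (L : ℝ) ^ 2)⁻¹ * A *
        ∑ k ∈ (univ : Finset (FreqMomentum L M)).filter (fun k => klTorusNorm L (k.2 - x) ≤ ρ), |a k| * ‖propCT L M β μ K k‖ := by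
  classical
  have hc : 0 ≤ (β * (L : ℝ) ^ 2)⁻¹ := by positivity
  set soft : FreqMomentum L M → ℝ := fun k => |a k| * ‖propCT L M β μ K k‖ with hsoft
  have hsoft0 : ∀ k, 0 ≤ soft k := fun k => mul_nonneg (abs_nonneg _) (norm_nonneg _)
  have hplain : ∑ p : TorusSite 2 L, (if klTorusNorm L (p - x) ≤ ρ then ∑ ν : MatsubaraIdx M, soft (ν, p) else 0) =
      ∑ k ∈ (univ : Finset (FreqMomentum L M)).filter (fun k => klTorusNorm L (k.2 - x) ≤ ρ), soft k := by
    rw [Finset.sum_filter, Fintype.sum_prod_type, Finset.sum_comm]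
    refine Finset.sum_congr rfl fun q _ => ?_
    split_ifs with h
    · rfl
    · simp
  rw [Finset.sum_filter]
  calc ∑ p, (if klTorusNorm L (p - x) ≤ ρ then |klBubbleMass L M β μ K a b Qm p| else 0)
      ≤ ∑ p, (if klTorusNorm L (p - x) ≤ ρ then (β * (L : ℝ) ^ 2)⁻¹ * (A * ∑ ν : MatsubaraIdx M, soft (ν, p)) else 0) := by
        refine sum_le_sum fun p _ => ?_
        split_ifs with h
        · refine (abs_klBubbleMass_le β μ K hβ a b Qm p).trans ?_
          refine mul_le_mul_of_nonneg_left ?_ hc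
          rw [Finset.mul_sum]
          exact sum_le_sum fun ν _ => (mul_le_mul_of_nonneg_left (hA _) (hsoft0 _)).trans (le_of_eq (mul_comm _ _))
        · exact le_rfl
    _ = (β * (L : ℝ) ^ 2)⁻¹ * A * ∑ p, (if klTorusNorm L (p - x) ≤ ρ then ∑ ν : MatsubaraIdx M, soft (ν, p) else 0) := by
        rw [Finset.mul_sum]
        refine Finset.sum_congr rfl fun p _ => ?_
        split_ifs <;> ring
    _ = (β * (L : ℝ) ^ 2)⁻¹ * A *
          ∑ k ∈ (univ : Finset (FreqMomentum L M)).filter (fun k => klTorusNorm L (k.2 - x) ≤ ρ), soft k := by rw [hplain]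

/-- **WINDOWED MASS OF THE TRANSFER WEIGHT**: on an admissible frame, `klBetaMin ≤ β ≤ L`, `n ≤ m`, `0 ≤ D ≤ 1 − w^K_{Λ_m}`, every pair momentum `Qm`, centre `x`, radius
`ρ ≥ 0`: `Σ_{p : |p − x|_𝕋 ≤ ρ} |tₙ^K[D](Qm, p)| ≤ 61524·(ρ/π + 1/L)·4^{−(m−n)}` — the weight's mass is SPREAD along the Fermi curve: a window of torus radius `ρ` carries at
most the fraction `ρ/π + 1/L` of the total's bound `4·15367·4^{−(m−n)}` (up to `61524/61468`). -/
theorem sum_window_abs_klTransferWeight_le (hK : FrameOK R U N μ K) (hβ : klBetaMin ≤ β) (hβL : β ≤ L) {n m : ℕ} (hnm : n ≤ m)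
    {D : FreqMomentum L M → ℝ} (hD : ∀ k, 0 ≤ D k ∧ D k ≤ 1 - hubbardCutoffWeightCT L M β μ K (klScale klE0 m) k) (Qm x : TorusSite 2 L)
    {ρ : ℝ} (hρ : 0 ≤ ρ) :
    ∑ p ∈ (univ : Finset (TorusSite 2 L)).filter (fun p => klTorusNorm L (p - x) ≤ ρ), |klTransferWeight L M β μ K n D Qm p| ≤
      61524 * (ρ / π + ((L : ℝ))⁻¹) * ((4 : ℝ) ^ (m - n))⁻¹ := by
  have hβ0 : 0 < β := pos_of_klBetaMin_le hβ
  have hΛ : 0 < klScale klE0 n := klth_klScale_pos n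
  have hL : (0 : ℝ) < L := lt_of_lt_of_le hβ0 hβL
  have hπ := Real.pi_pos
  have hA := abs_hubbardCutoffWeightCT_mul_norm_propCT_le (L := L) (M := M) β μ K hΛ
  have h1 := sum_window_abs_klBubbleMass_le_of_left β μ K hβ0 D hA Qm x ρ
  have h2 := sum_window_abs_klBubbleMass_le_of_right β μ K hβ0 D hA Qm x ρ
  have hs1 := sum_window_softSymbol_mul_norm_propCT_le β μ K hK hβ hβL m hD (Qm - x) hρ
  have hs2 := sum_window_softSymbol_mul_norm_propCT_le β μ K hK hβ hβL m hD x hρ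
  have hc : 0 ≤ (β * (L : ℝ) ^ 2)⁻¹ * (2 / klScale klE0 n) := by positivity
  have hratio : klScale klE0 m / klScale klE0 n = ((4 : ℝ) ^ (m - n))⁻¹ := klth_klScale_div_klScale hnm
  calc ∑ p ∈ (univ : Finset (TorusSite 2 L)).filter (fun p => klTorusNorm L (p - x) ≤ ρ), |klTransferWeight L M β μ K n D Qm p|
      ≤ ∑ p ∈ (univ : Finset (TorusSite 2 L)).filter (fun p => klTorusNorm L (p - x) ≤ ρ),
          (|klBubbleMass L M β μ K (hubbardCutoffWeightCT L M β μ K (klScale klE0 n)) D Qm p| +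
            |klBubbleMass L M β μ K D (hubbardCutoffWeightCT L M β μ K (klScale klE0 n)) Qm p|) :=
        sum_le_sum fun p _ => by rw [klTransferWeight_eq_neg_bubbleMass, abs_neg]; exact abs_add_le _ _
    _ ≤ (β * (L : ℝ) ^ 2)⁻¹ * (2 / klScale klE0 n) * (15381 * (ρ / π + ((L : ℝ))⁻¹) * klScale klE0 m * β * (L : ℝ) ^ 2) +
          (β * (L : ℝ) ^ 2)⁻¹ * (2 / klScale klE0 n) * (15381 * (ρ / π + ((L : ℝ))⁻¹) * klScale klE0 m * β * (L : ℝ) ^ 2) := by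
        rw [sum_add_distrib]
        exact add_le_add (h1.trans (mul_le_mul_of_nonneg_left hs1 hc)) (h2.trans (mul_le_mul_of_nonneg_left hs2 hc))
    _ = 61524 * (ρ / π + ((L : ℝ))⁻¹) * (klScale klE0 m / klScale klE0 n) := by
        field_simp
        ring
    _ = 61524 * (ρ / π + ((L : ℝ))⁻¹) * ((4 : ℝ) ^ (m - n))⁻¹ := by rw [hratio]

/-- **Index-family form**: for the pair `(s_{n,m} | s_{n,m′})`, `n ≤ m′ ≤ m`, the windowed mass of the weight of the difference `s_{m′,m}`:
`Σ_{p : |p − x|_𝕋 ≤ ρ} |tₙ^K[s_{n,m} − s_{n,m′}](Qm,p)| ≤ 61524·(ρ/π + 1/L)·4^{−(m′−n)}`. -/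
theorem sum_window_abs_klTransferWeight_compl_sub_compl_le (hK : FrameOK R U N μ K) (hβ : klBetaMin ≤ β) (hβL : β ≤ L) {n m m' : ℕ}
    (hn : n ≤ m') (h : m' ≤ m) (Qm x : TorusSite 2 L) {ρ : ℝ} (hρ : 0 ≤ ρ) :
    ∑ p ∈ (univ : Finset (TorusSite 2 L)).filter (fun p => klTorusNorm L (p - x) ≤ ρ),
        |klTransferWeight L M β μ K n (softSymbolCompl L M β μ K n m - softSymbolCompl L M β μ K n m') Qm p| ≤
      61524 * (ρ / π + ((L : ℝ))⁻¹) * ((4 : ℝ) ^ (m' - n))⁻¹ :=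
  sum_window_abs_klTransferWeight_le β μ K hK hβ hβL hn (softSymbolCompl_sub_compl_mem β μ K n h) Qm x hρ

/-- The same for the DIFFERENCE OF THE TWO MEMBERS' WEIGHTS `tₙ^K[s_{n,m}] − tₙ^K[s_{n,m′}]` (the relative weight `aʰ`, `a(0)`, `a(1)` of the step). -/
theorem sum_window_abs_klTransferWeight_compl_sub_le (hK : FrameOK R U N μ K) (hβ : klBetaMin ≤ β) (hβL : β ≤ L) {n m m' : ℕ}
    (hn : n ≤ m') (h : m' ≤ m) (Qm x : TorusSite 2 L) {ρ : ℝ} (hρ : 0 ≤ ρ) :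
    ∑ p ∈ (univ : Finset (TorusSite 2 L)).filter (fun p => klTorusNorm L (p - x) ≤ ρ),
        |klTransferWeight L M β μ K n (softSymbolCompl L M β μ K n m) Qm p - klTransferWeight L M β μ K n (softSymbolCompl L M β μ K n m') Qm p| ≤
      61524 * (ρ / π + ((L : ℝ))⁻¹) * ((4 : ℝ) ^ (m' - n))⁻¹ := by
  have hsub : ∀ p, klTransferWeight L M β μ K n (softSymbolCompl L M β μ K n m) Qm p -
      klTransferWeight L M β μ K n (softSymbolCompl L M β μ K n m') Qm p =
      klTransferWeight L M β μ K n (softSymbolCompl L M β μ K n m - softSymbolCompl L M β μ K n m') Qm p :=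
    fun p => klTransferWeight_sub β μ K n _ _ Qm p
  simp_rw [hsub]
  exact sum_window_abs_klTransferWeight_compl_sub_compl_le β μ K hK hβ hβL hn h Qm x hρ

/-- **The `A·η` shape the door's layer cake consumes** (`klam_relGain_angular_le`, p593991: `Σ_{d(c) ≤ η} w_c ≤ A·η` for `η ≥ η₀`): for `π/L ≤ η`,
`Σ_{p : |p − x|_𝕋 ≤ η} |tₙ^K[s_{n,m}](Qm,p) − tₙ^K[s_{n,m′}](Qm,p)| ≤ (2·61524/π)·4^{−(m′−n)}·η` (the `1/L` rounding absorbed by `1/L ≤ η/π`), with `η₀ = π/L`. -/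
theorem sum_window_abs_klTransferWeight_compl_sub_le_linear (hK : FrameOK R U N μ K) (hβ : klBetaMin ≤ β) (hβL : β ≤ L) {n m m' : ℕ}
    (hn : n ≤ m') (h : m' ≤ m) (Qm x : TorusSite 2 L) {η : ℝ} (hη : Real.pi / L ≤ η) :
    ∑ p ∈ (univ : Finset (TorusSite 2 L)).filter (fun p => klTorusNorm L (p - x) ≤ η),
        |klTransferWeight L M β μ K n (softSymbolCompl L M β μ K n m) Qm p - klTransferWeight L M β μ K n (softSymbolCompl L M β μ K n m') Qm p| ≤
      2 * 61524 / π * ((4 : ℝ) ^ (m' - n))⁻¹ * η := by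
  have hL : (0 : ℝ) < L := Nat.cast_pos.2 (Nat.pos_of_ne_zero (NeZero.ne L))
  have hπ := Real.pi_pos
  have hη0 : 0 ≤ η := le_trans (by positivity) hη
  refine (sum_window_abs_klTransferWeight_compl_sub_le β μ K hK hβ hβL hn h Qm x hη0).trans ?_
  have h4 : 0 ≤ ((4 : ℝ) ^ (m' - n))⁻¹ := by positivity
  have hinv : ((L : ℝ))⁻¹ ≤ η / π := by
    rw [inv_eq_one_div, div_le_div_iff₀ hL hπ]
    rw [div_le_iff₀ hL] at hη
    linarith
  have : 61524 * (η / π + ((L : ℝ))⁻¹) * ((4 : ℝ) ^ (m' - n))⁻¹ ≤ 61524 * (η / π + η / π) * ((4 : ℝ) ^ (m' - n))⁻¹ := by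
    gcongr
  refine this.trans (le_of_eq ?_)
  field_simp
  ring

/-- The windowed soft sum in the `A·η` shape: `π/L ≤ η` ⇒ `Σ_{k : |p_{k⃗}−p_{x⃗}|_𝕋 ≤ η} |φ(k)|‖ĝ_K(k)‖ ≤ (2·15381/π)·Λ_m·βL²·η`. -/
theorem sum_window_softSymbol_mul_norm_propCT_le_linear (hK : FrameOK R U N μ K) (hβ : klBetaMin ≤ β) (hβL : β ≤ L) (m : ℕ)
    {φ : FreqMomentum L M → ℝ} (hφ : ∀ k, 0 ≤ φ k ∧ φ k ≤ 1 - hubbardCutoffWeightCT L M β μ K (klScale klE0 m) k) (x : TorusSite 2 L)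
    {η : ℝ} (hη : Real.pi / L ≤ η) :
    ∑ k ∈ (univ : Finset (FreqMomentum L M)).filter (fun k => klTorusNorm L (k.2 - x) ≤ η), |φ k| * ‖propCT L M β μ K k‖ ≤
      2 * 15381 / π * klScale klE0 m * β * (L : ℝ) ^ 2 * η := by
  have hL : (0 : ℝ) < L := Nat.cast_pos.2 (Nat.pos_of_ne_zero (NeZero.ne L))
  have hπ := Real.pi_pos
  have hη0 : 0 ≤ η := le_trans (by positivity) hη
  have hβ0 : 0 < β := pos_of_klBetaMin_le hβ
  have hΛ : 0 < klScale klE0 m := klth_klScale_pos m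
  refine (sum_window_softSymbol_mul_norm_propCT_le β μ K hK hβ hβL m hφ x hη0).trans ?_
  have hinv : ((L : ℝ))⁻¹ ≤ η / π := by
    rw [inv_eq_one_div, div_le_div_iff₀ hL hπ]
    rw [div_le_iff₀ hL] at hη
    linarith
  have hpos : 0 ≤ klScale klE0 m * β * (L : ℝ) ^ 2 := by positivity
  have : 15381 * (η / π + ((L : ℝ))⁻¹) * klScale klE0 m * β * (L : ℝ) ^ 2 ≤ 15381 * (η / π + η / π) * klScale klE0 m * β * (L : ℝ) ^ 2 := by
    gcongr
  refine this.trans (le_of_eq ?_)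
  field_simp
  ring

end Transfer

end Summit.HubbardSuperconductivity.HubbardSuperconductivity.Theorems.KLRegimeSplit

end
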